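import Literature.NumberTheory.Automorphic.UnitaryGroupAdelicCentralizerProduct
import Literature.NumberTheory.Automorphic.UnitaryGroupAutomorphicMeasure
import Literature.NumberTheory.Automorphic.AutomorphicQuotientKernel
import Literature.NumberTheory.Automorphic.UnitaryGroupQuasiSplitCMDatum
import Literature.MeasureTheory.Group.InvariantQuotientFiniteCovolume
import HarnessLib

/-!
# Finite covolume of the centraliser lattice at a SINGULAR semisimple rational class of `U(H)`,
# `H ∈ M₃(L)` (quasi-split `U(J₃)` included): `vol(G_γ(L⁺)\G_γ(𝔸_{L⁺})) < ∞`
(Rogawski, *Automorphic Representations of Unitary Groups in Three Variables* (1990), §3.8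
Prop. 3.8.1 (a) p. 27: `G_γ ≅ U(H_a) × U(H_b)`; §7.2 Prop. 7.2.1 p. 91: the term
`m(G_γ(F)\G_γ(𝔸)) Φ(γ, f)` of `J^T_𝔬(f)` at the singular class meeting the Borel; Borel (1963),
Thm. 5.8: finite invariant volume of `G_k\G_A`.)

Topic `NumberTheory/Automorphic`; namespace `Literature.NumberTheory.Automorphic.UnitaryGroup`.  THEOREMS ONLY (no definition, no instance, no
named fact, no notation, no `sorry`).  Cell `pub/hodgecm-mathlib`, ENGINE T1 (crux `H413` =
`stmt-HodgeConjecture-24833`), T1-qs road LAW 5, letter (L5-iii-b)-cov: the finite-covolume input of the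
unfolding of the semisimple part of the singular Borel class `γ = d(a, b, a)` of `U(J₃)` — in the currency
of ★ `UnitaryGroupKernelClassOrbitalUnfolding` §3 the weight
`vol = quotientMeasure ((G(F) ⊓ C(γ)).subgroupOf C(γ)) ρ _ ν_γ (univ)` must be FINITE, while — unlike the
elliptic classes of ★ `UnitaryGroupEllipticCentralizerCompact` — `C(γ) ⧸ (G(F) ⊓ C(γ))` is NOT compact
(the centraliser `U(1,1) × U(1)` is isotropic).  HC_CM is proved only modulo the printed citations until
rung 0 closes; this file discharges none of them.

ROAD (no new reduction theory): ★ Prop. 3.8.1 (a) (`UnitaryGroupAdelicCentralizerProduct`,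
`UnitaryGroupBlockCentralizer`) exhibits the adelic centraliser of a singular semisimple `γ ∈ U(H)(L⁺)` as
the image of the continuous homomorphism `U(H_a)(𝔸) × U(H_b)(𝔸) → U(H)(𝔸)` (block-diagonal embedding
followed by the congruence of a frame `P`), which carries RATIONAL points to rational points; ★
Borel–Harish-Chandra `exists_isAutomorphicMeasure_cmDatum_of_isHermitian` (unconditional, every
hermitian `H_a`, `H_b`) gives FINITE invariant measures on `U(H_a)(𝔸)⧸U(H_a)(L⁺)`, `U(H_b)(𝔸)⧸U(H_b)(L⁺)`;
the push-forward of their product is a finite `C(γ)`-invariant non-zero measure on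
`C(γ) ⧸ (G(F) ⊓ C(γ))`, and uniqueness of invariant measures (★ `eq_unfoldingConstant_smul_quotientMeasure`)
bounds the Weil quotient measure of ANY Haar measure of `C(γ)` by it.

* (generic transport: ★ `InvariantQuotientFiniteCovolume` — `quotientMeasure_univ_lt_top_of_isFiniteMeasure`,
  `quotientMeasure_univ_lt_top_of_surjective_prod`.)
* **`quotientMeasure_centralizer_univ_lt_top_of_singular`** (`U(H)`, `H ∈ M₃(L)` hermitian non-degenerate over a
  CM field `L`) — for `γ ∈ U(H)(L⁺)` semisimple, not regular,
  not scalar: `quotientMeasure ((A_G·G(L⁺) ⊓ C(γ)).subgroupOf C(γ)) ρ _ ν_γ univ < ∞` for every Haar pair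
  `(ρ, ν_γ)` — the `vol` of the (L4) unfolding currency at the singular semisimple classes, in particular at
  `γ = d(a, b, a)` of the quasi-split `U(J₃) = cmDatum L 3 J₃` (★ `quasiSplit_eq_cmDatum`);
  **`quotientMeasure_centralizer_univ_lt_top_of_singular_quasiSplit`** — the same in the letters of
  `quasiSplit L⁺ L c 3` (the (L4) currency: topological binders on `U(J₃)(𝔸)`, data instances threaded).

## References
* J. D. Rogawski, *Automorphic Representations of Unitary Groups in Three Variables*, Ann. of Math.
  Stud. 123 (1990), §3.8 Prop. 3.8.1 (a) p. 27, §7.2 Prop. 7.2.1 p. 91 [Rogawski1990].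
* A. Borel, *Some finiteness properties of adele groups over number fields*, Publ. Math. IHÉS 16
  (1963), §5 Thm. 5.8 [Borel1963].
* J. R. Getz, H. Hahn, *An Introduction to Automorphic Representations* (2024), Thm. 2.6.2, Thm. 3.2.2
  [GetzHahn2024].
-/

set_option autoImplicit false

noncomputable section

open MeasureTheory Measure Set Topology
open scoped NNReal ENNReal Pointwise

/-! ## `U(H)`, `H ∈ M₃(L)`: the centraliser lattice at a singular semisimple class has finite covolume -/

namespace Literature.NumberTheory.Automorphic.UnitaryGroup

open _root_.NumberField Literature.MeasureTheory.Group Literature.NumberTheory.Rogawski1990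
open Literature.AlgebraicGeometry.ShimuraVarieties (unitaryGroup mem_unitaryGroup_iff)
open scoped _root_.MatrixGroups _root_.Matrix

variable (L : Type) [Field L] [NumberField L] [IsCMField L] (H : Matrix (Fin 3) (Fin 3) L)

/-- **Finite covolume of the centraliser lattice at a SINGULAR semisimple rational class** [Rogawski1990,
§3.8 Prop. 3.8.1 (a); §7.2 Prop. 7.2.1, the weight `m(G_γ(F)\G_γ(𝔸))`].  Let `L` be a CM field, `H ∈ M₃(L)`
hermitian with `det H ≠ 0`, and `γ ∈ U(H)(L⁺)` semisimple, NOT regular and NOT a scalar (e.g. the torus element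
`d(a, b, a)`, `a ≠ b`, of the quasi-split `U(J₃)`: centraliser `U(1,1) × U(1)`, ISOTROPIC).  Then for every Haar
measure `ν_γ` of the adelic centraliser `C(γ) = C_{U(H)(𝔸)}(γ)` (two-sided) and every two-sided Haar measure
`ρ` of the discrete subgroup `A_G·U(H)(L⁺) ∩ C(γ)`, the Weil quotient measure of `C(γ) ⧸ (A_G·U(H)(L⁺) ∩ C(γ))`
has FINITE total mass — the `vol(G_γ ⧸ G(F)_γ)` of ★ `lintegral_conjTsum_fiber_eq_mul_tsum_covol_mul` at the
singular semisimple classes.  Proof: ★ Prop. 3.8.1 (a) frame `γP = P(a·1 ⊕ b·1)`, `ᵗP̄HP = H_a ⊕ H_b`; the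
continuous homomorphism `U(H_a)(𝔸) × U(H_b)(𝔸) → U(H)(𝔸)`, `(u₁, u₂) ↦ P (u₁ ⊕ u₂) P⁻¹`, is ONTO `C(γ)`
(★ `centralizer_toAdelic_eq_range_adelicBlockDiag`) and carries rational points to rational points;
Borel–Harish-Chandra ★ `exists_isAutomorphicMeasure_cmDatum_of_isHermitian` for `H_a`, `H_b`; transport
`quotientMeasure_univ_lt_top_of_surjective_prod`. [cite: Rogawski1990, §3.8 Prop. 3.8.1 p. 27]
[cite: Borel1963, Thm. 5.8] -/
theorem quotientMeasure_centralizer_univ_lt_top_of_singular (hH : (H.map (cmConjRingHom L))ᵀ = H)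
    (hdet : H.det ≠ 0) (γ : (cmDatum L 3 H).Rational) (hss : Rogawski1990.IsSemisimpleElt (cmConjRingHom L) H γ)
    (hnreg : ¬ IsRegularElt (γ.val : GL (Fin 3) L))
    (hnsc : ∀ ζ : L, ((γ.val : GL (Fin 3) L) : Matrix (Fin 3) (Fin 3) L) ≠ ζ • 1)
    [MeasurableSpace (cmDatum L 3 H).Adelic] [BorelSpace (cmDatum L 3 H).Adelic]
    [hCcl : IsClosed ((Subgroup.centralizer ({(cmDatum L 3 H).toAdelic γ} : Set (cmDatum L 3 H).Adelic)) :
      Set (cmDatum L 3 H).Adelic)]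
    (hΛ : IsClosed (((((cmDatum L 3 H).quotientSubgroup ⊓
        Subgroup.centralizer ({(cmDatum L 3 H).toAdelic γ} : Set (cmDatum L 3 H).Adelic)).subgroupOf
        (Subgroup.centralizer ({(cmDatum L 3 H).toAdelic γ} : Set (cmDatum L 3 H).Adelic))) :
        Subgroup ↥(Subgroup.centralizer ({(cmDatum L 3 H).toAdelic γ} : Set (cmDatum L 3 H).Adelic))) :
      Set ↥(Subgroup.centralizer ({(cmDatum L 3 H).toAdelic γ} : Set (cmDatum L 3 H).Adelic))))
    [MeasurableSpace (↥(Subgroup.centralizer ({(cmDatum L 3 H).toAdelic γ} : Set (cmDatum L 3 H).Adelic)) ⧸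
      ((cmDatum L 3 H).quotientSubgroup ⊓
        Subgroup.centralizer ({(cmDatum L 3 H).toAdelic γ} : Set (cmDatum L 3 H).Adelic)).subgroupOf
        (Subgroup.centralizer ({(cmDatum L 3 H).toAdelic γ} : Set (cmDatum L 3 H).Adelic)))]
    [BorelSpace (↥(Subgroup.centralizer ({(cmDatum L 3 H).toAdelic γ} : Set (cmDatum L 3 H).Adelic)) ⧸
      ((cmDatum L 3 H).quotientSubgroup ⊓
        Subgroup.centralizer ({(cmDatum L 3 H).toAdelic γ} : Set (cmDatum L 3 H).Adelic)).subgroupOf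
        (Subgroup.centralizer ({(cmDatum L 3 H).toAdelic γ} : Set (cmDatum L 3 H).Adelic)))]
    (ρ : Measure ↥(((cmDatum L 3 H).quotientSubgroup ⊓
        Subgroup.centralizer ({(cmDatum L 3 H).toAdelic γ} : Set (cmDatum L 3 H).Adelic)).subgroupOf
        (Subgroup.centralizer ({(cmDatum L 3 H).toAdelic γ} : Set (cmDatum L 3 H).Adelic))))
    [ρ.IsMulLeftInvariant] [IsFiniteMeasureOnCompacts ρ] [ρ.IsOpenPosMeasure] [ρ.IsInvInvariant] [SFinite ρ]
    (νC : Measure ↥(Subgroup.centralizer ({(cmDatum L 3 H).toAdelic γ} : Set (cmDatum L 3 H).Adelic)))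
    [IsHaarMeasure νC] [νC.IsMulRightInvariant] :
    quotientMeasure (((cmDatum L 3 H).quotientSubgroup ⊓
        Subgroup.centralizer ({(cmDatum L 3 H).toAdelic γ} : Set (cmDatum L 3 H).Adelic)).subgroupOf
        (Subgroup.centralizer ({(cmDatum L 3 H).toAdelic γ} : Set (cmDatum L 3 H).Adelic))) ρ hΛ νC
      Set.univ < ∞ := by
  classical
  -- (0) the frame of ★ Prop. 3.8.1 (a)
  have hσ : ∀ x : L, cmConjRingHom L (cmConjRingHom L x) = x := IsCMField.complexConj_apply_apply L
  obtain ⟨a, b, P, Ha, Hb, hab, -, -, hP, hγP, hHa, hHb, hda, hdb⟩ :=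
    exists_singular_frame_of_isSemisimpleElt (cmConjRingHom L) hσ H hH hdet γ hss hnreg hnsc
  set H' : Matrix (Fin 3) (Fin 3) L := finSum 2 1 Ha Hb with hH'def
  set δ₀ : GL (Fin 3) L := P⁻¹ * (γ.val : GL (Fin 3) L) * P with hδ₀def
  have hδ₀ : (δ₀ : Matrix (Fin 3) (Fin 3) L) = finSum 2 1 (a • (1 : Matrix (Fin 2) (Fin 2) L)) (b • 1) := by
    rw [hδ₀def, Units.val_mul, Units.val_mul, Matrix.mul_assoc, hγP, ← Matrix.mul_assoc, ← Units.val_mul, inv_mul_cancel,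
      Units.val_one, Matrix.one_mul]
  have hP' : (((P⁻¹ : GL (Fin 3) L) : Matrix (Fin 3) (Fin 3) L).map (cmConjRingHom L))ᵀ * H' *
      ((P⁻¹ : GL (Fin 3) L) : Matrix (Fin 3) (Fin 3) L) = H := by
    rw [← hP]
    have h1 : (((P⁻¹ : GL (Fin 3) L) : Matrix (Fin 3) (Fin 3) L).map (cmConjRingHom L))ᵀ *
        (((P : Matrix (Fin 3) (Fin 3) L)).map (cmConjRingHom L))ᵀ = 1 := by
      rw [← Matrix.transpose_mul, ← Matrix.map_mul, ← Units.val_mul, mul_inv_cancel, Units.val_one,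
        Matrix.map_one _ (map_zero _) (map_one _), Matrix.transpose_one]
    calc (((P⁻¹ : GL (Fin 3) L) : Matrix (Fin 3) (Fin 3) L).map (cmConjRingHom L))ᵀ *
          ((((P : Matrix (Fin 3) (Fin 3) L)).map (cmConjRingHom L))ᵀ * H * (P : Matrix (Fin 3) (Fin 3) L)) *
          ((P⁻¹ : GL (Fin 3) L) : Matrix (Fin 3) (Fin 3) L)
        = ((((P⁻¹ : GL (Fin 3) L) : Matrix (Fin 3) (Fin 3) L).map (cmConjRingHom L))ᵀ *
            (((P : Matrix (Fin 3) (Fin 3) L)).map (cmConjRingHom L))ᵀ) * H *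
            ((P : Matrix (Fin 3) (Fin 3) L) * ((P⁻¹ : GL (Fin 3) L) : Matrix (Fin 3) (Fin 3) L)) := by
          simp only [Matrix.mul_assoc]
      _ = H := by rw [h1, ← Units.val_mul, mul_inv_cancel, Units.val_one, Matrix.one_mul, Matrix.mul_one]
  have hδ₀mem : δ₀ ∈ unitaryGroup (cmConjRingHom L) H' := by
    have h := conj_mem_unitaryGroup_of_congr (cmConjRingHom L) (P⁻¹) H' H hP' (x := (γ.val : GL (Fin 3) L)) γ.2
    rwa [inv_inv] at h
  let δ : (cmDatum L 3 H').Rational := ⟨δ₀, hδ₀mem⟩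
  -- the same element in the generic currency
  let δ' : rational (↥(maximalRealSubfield L)) L (IsCMField.complexConj L) (2 + 1) (finSum 2 1 Ha Hb) :=
    ⟨δ₀, by rw [rational_complexConj]; exact hδ₀mem⟩
  have hδ' : ((δ' : GL (Fin (2 + 1)) L) : Matrix _ _ L) = finSum 2 1 (a • (1 : Matrix (Fin 2) (Fin 2) L)) (b • 1) := hδ₀
  set y₀ := toAdelic (↥(maximalRealSubfield L)) L (IsCMField.complexConj L) (2 + 1) (finSum 2 1 Ha Hb) δ' with hy₀def
  -- (1) the homomorphisms
  let bd := adelicBlockDiag (↥(maximalRealSubfield L)) L (IsCMField.complexConj L) 2 1 Ha Hb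
  have hrange : Subgroup.centralizer ({y₀} : Set ↥(adelic (↥(maximalRealSubfield L)) L (IsCMField.complexConj L) (2 + 1)
      (finSum 2 1 Ha Hb))) = bd.range :=
    centralizer_toAdelic_eq_range_adelicBlockDiag (↥(maximalRealSubfield L)) L (IsCMField.complexConj L) 2 1 Ha Hb hab δ' hδ'
  let f₁ : (cmDatum L 2 Ha).Adelic →* ↥(adelic (↥(maximalRealSubfield L)) L (IsCMField.complexConj L) 2 Ha) :=
    Subgroup.inclusion (adelicUnitaryGroup_le_adelic L 2 Ha)
  let g₁ : (cmDatum L 1 Hb).Adelic →* ↥(adelic (↥(maximalRealSubfield L)) L (IsCMField.complexConj L) 1 Hb) :=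
    Subgroup.inclusion (adelicUnitaryGroup_le_adelic L 1 Hb)
  let f₂ : ↥(adelic (↥(maximalRealSubfield L)) L (IsCMField.complexConj L) 2 Ha) →* (cmDatum L 2 Ha).Adelic :=
    Subgroup.inclusion (adelic_complexConj L 2 Ha).le
  let g₂ : ↥(adelic (↥(maximalRealSubfield L)) L (IsCMField.complexConj L) 1 Hb) →* (cmDatum L 1 Hb).Adelic :=
    Subgroup.inclusion (adelic_complexConj L 1 Hb).le
  let e₂ : ↥(adelic (↥(maximalRealSubfield L)) L (IsCMField.complexConj L) (2 + 1) (finSum 2 1 Ha Hb)) →*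
      (cmDatum L 3 H').Adelic :=
    Subgroup.inclusion (adelic_complexConj L (2 + 1) (finSum 2 1 Ha Hb)).le
  let e₂' : (cmDatum L 3 H').Adelic →*
      ↥(adelic (↥(maximalRealSubfield L)) L (IsCMField.complexConj L) (2 + 1) (finSum 2 1 Ha Hb)) :=
    Subgroup.inclusion (adelic_complexConj L (2 + 1) (finSum 2 1 Ha Hb)).ge
  let e₃ : (cmDatum L 3 H').Adelic ≃ₜ* (cmDatum L 3 H).Adelic := adelicUnitaryGroupCongr L P H H' hP
  let e : (cmDatum L 2 Ha).Adelic × (cmDatum L 1 Hb).Adelic →* (cmDatum L 3 H).Adelic :=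
    e₃.toMonoidHom.comp (e₂.comp (bd.comp (MonoidHom.prodMap f₁ g₁)))
  have he_apply : ∀ u, e u = e₃ (e₂ (bd (f₁ u.1, g₁ u.2))) := fun _ => rfl
  have hcont : Continuous e := by
    refine e₃.continuous.comp ((Continuous.subtype_mk continuous_subtype_val _).comp
      ((continuous_adelicBlockDiag _ L _ 2 1 Ha Hb).comp ?_))
    exact ((Continuous.subtype_mk continuous_subtype_val _).comp continuous_fst).prodMk
      ((Continuous.subtype_mk continuous_subtype_val _).comp continuous_snd)
  -- (2) `γA = e₃ (e₂ y₀)`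
  have he₂y₀ : e₂ y₀ = (cmDatum L 3 H').toAdelic δ := Subtype.ext rfl
  have he₃δ : e₃ ((cmDatum L 3 H').toAdelic δ) = (cmDatum L 3 H).toAdelic γ := by
    apply Subtype.ext
    show toAdeleGL L P * toAdeleGL L δ₀ * (toAdeleGL L P)⁻¹ = toAdeleGL L (γ.val : GL (Fin 3) L)
    rw [← map_inv, ← map_mul, ← map_mul, hδ₀def, ← mul_assoc, ← mul_assoc, mul_inv_cancel, one_mul, mul_assoc,
      mul_inv_cancel, mul_one]
  have hγA : e₃ (e₂ y₀) = (cmDatum L 3 H).toAdelic γ := by rw [he₂y₀, he₃δ]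
  have he₂'γA : e₂' (e₃.symm ((cmDatum L 3 H).toAdelic γ)) = y₀ := by
    rw [← hγA, ContinuousMulEquiv.symm_apply_apply]
    exact Subtype.ext rfl
  -- (3) `e` maps ONTO the centraliser
  have heC : ∀ u, e u ∈ Subgroup.centralizer ({(cmDatum L 3 H).toAdelic γ} : Set (cmDatum L 3 H).Adelic) := by
    intro u
    have hw : bd (f₁ u.1, g₁ u.2) ∈ Subgroup.centralizer ({y₀} : Set _) := by rw [hrange]; exact ⟨_, rfl⟩
    have hcomm := Subgroup.mem_centralizer_singleton_iff.1 hw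
    rw [Subgroup.mem_centralizer_singleton_iff, he_apply, ← hγA, ← map_mul, ← map_mul, hcomm, map_mul, map_mul]
  have hCe : ∀ z ∈ Subgroup.centralizer ({(cmDatum L 3 H).toAdelic γ} : Set (cmDatum L 3 H).Adelic), ∃ u, e u = z := by
    intro z hz
    have hz' : e₂' (e₃.symm z) ∈ Subgroup.centralizer ({y₀} : Set _) := by
      rw [Subgroup.mem_centralizer_singleton_iff] at hz ⊢
      have h1 : e₃.symm z * e₃.symm ((cmDatum L 3 H).toAdelic γ) = e₃.symm ((cmDatum L 3 H).toAdelic γ) * e₃.symm z := by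
        rw [← map_mul, ← map_mul, hz]
      have h2 := congrArg e₂' h1
      rw [map_mul, map_mul, he₂'γA] at h2
      exact h2
    rw [hrange] at hz'
    obtain ⟨w, hw⟩ := hz'
    refine ⟨(f₂ w.1, g₂ w.2), ?_⟩
    have h1 : (f₁ (f₂ w.1), g₁ (g₂ w.2)) = w := Prod.ext (Subtype.ext rfl) (Subtype.ext rfl)
    have h2 : e₂ (e₂' (e₃.symm z)) = e₃.symm z := Subtype.ext rfl
    rw [he_apply, h1, hw, h2, ContinuousMulEquiv.apply_symm_apply]
  -- (4) rational points go to rational points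
  have hΓ : ∀ γ₁ ∈ (cmDatum L 2 Ha).quotientSubgroup, ∀ γ₂ ∈ (cmDatum L 1 Hb).quotientSubgroup,
      (⟨e (γ₁, γ₂), heC _⟩ : ↥(Subgroup.centralizer ({(cmDatum L 3 H).toAdelic γ} : Set (cmDatum L 3 H).Adelic))) ∈
        (((cmDatum L 3 H).quotientSubgroup ⊓
          Subgroup.centralizer ({(cmDatum L 3 H).toAdelic γ} : Set (cmDatum L 3 H).Adelic)).subgroupOf
          (Subgroup.centralizer ({(cmDatum L 3 H).toAdelic γ} : Set (cmDatum L 3 H).Adelic))) := by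
    intro γ₁ hγ₁ γ₂ hγ₂
    rw [Subgroup.mem_subgroupOf, Subgroup.mem_inf]
    refine ⟨?_, heC _⟩
    rw [cmDatum_quotientSubgroup] at hγ₁ hγ₂
    obtain ⟨x₁, hx₁, hx₁γ⟩ := (mem_adelicUnitaryRat_iff L Ha γ₁).1 hγ₁
    obtain ⟨x₂, hx₂, hx₂γ⟩ := (mem_adelicUnitaryRat_iff L Hb γ₂).1 hγ₂
    let x₁' : rational (↥(maximalRealSubfield L)) L (IsCMField.complexConj L) 2 Ha := ⟨x₁, by rw [rational_complexConj]; exact hx₁⟩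
    let x₂' : rational (↥(maximalRealSubfield L)) L (IsCMField.complexConj L) 1 Hb := ⟨x₂, by rw [rational_complexConj]; exact hx₂⟩
    have hf₁ : f₁ γ₁ = toAdelic (↥(maximalRealSubfield L)) L (IsCMField.complexConj L) 2 Ha x₁' := by
      apply Subtype.ext
      show (γ₁.val : GL (Fin 2) (AdeleRing (𝓞 L) L)) = _
      rw [← hx₁γ]
      rfl
    have hg₁ : g₁ γ₂ = toAdelic (↥(maximalRealSubfield L)) L (IsCMField.complexConj L) 1 Hb x₂' := by
      apply Subtype.ext
      show (γ₂.val : GL (Fin 1) (AdeleRing (𝓞 L) L)) = _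
      rw [← hx₂γ]
      rfl
    set r := rationalBlockDiag (↥(maximalRealSubfield L)) L (IsCMField.complexConj L) 2 1 Ha Hb (x₁', x₂') with hrdef
    have hbd : bd (f₁ γ₁, g₁ γ₂) = toAdelic (↥(maximalRealSubfield L)) L (IsCMField.complexConj L) (2 + 1) (finSum 2 1 Ha Hb) r := by
      rw [hf₁, hg₁]
      exact adelicBlockDiag_toAdelic (↥(maximalRealSubfield L)) L (IsCMField.complexConj L) 2 1 Ha Hb x₁' x₂'
    have hmem' : e₂ (bd (f₁ γ₁, g₁ γ₂)) ∈ adelicUnitaryRat L H' := by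
      refine (mem_adelicUnitaryRat_iff L H' _).2 ⟨(r : GL (Fin (2 + 1)) L), by rw [← rational_complexConj]; exact r.2, ?_⟩
      rw [hbd]
      rfl
    show e (γ₁, γ₂) ∈ (cmDatum L 3 H).quotientSubgroup
    rw [cmDatum_quotientSubgroup, he_apply]
    exact adelicUnitaryGroupCongr_mem_rat L P H H' hP hmem'
  -- (5) Borel–Harish-Chandra for the two factors
  letI : MeasurableSpace (cmDatum L 2 Ha).Adelic := borel _
  haveI : BorelSpace (cmDatum L 2 Ha).Adelic := ⟨rfl⟩
  letI : MeasurableSpace (cmDatum L 1 Hb).Adelic := borel _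
  haveI : BorelSpace (cmDatum L 1 Hb).Adelic := ⟨rfl⟩
  obtain ⟨μa, hμa⟩ := exists_isAutomorphicMeasure_cmDatum_of_isHermitian L 2 Ha hHa hda
  obtain ⟨μb, hμb⟩ := exists_isAutomorphicMeasure_cmDatum_of_isHermitian L 1 Hb hHb hdb
  letI := (cmDatum L 2 Ha).measurableSpaceQuotientForm
  haveI := (cmDatum L 2 Ha).borelSpaceQuotientForm
  haveI := (cmDatum L 2 Ha).smulInvariantMeasureQuotientForm μa
  letI := (cmDatum L 1 Hb).measurableSpaceQuotientForm
  haveI := (cmDatum L 1 Hb).borelSpaceQuotientForm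
  haveI := (cmDatum L 1 Hb).smulInvariantMeasureQuotientForm μb
  haveI : @IsFiniteMeasure ((cmDatum L 2 Ha).Adelic ⧸ (cmDatum L 2 Ha).quotientSubgroup)
      (cmDatum L 2 Ha).measurableSpaceQuotientForm μa := hμa.toIsFiniteMeasure
  haveI : @IsFiniteMeasure ((cmDatum L 1 Hb).Adelic ⧸ (cmDatum L 1 Hb).quotientSubgroup)
      (cmDatum L 1 Hb).measurableSpaceQuotientForm μb := hμb.toIsFiniteMeasure
  have hμa0 := AdelicGroupData.IsAutomorphicMeasure.ne_zero (cmDatum L 2 Ha) μa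
  have hμb0 := AdelicGroupData.IsAutomorphicMeasure.ne_zero (cmDatum L 1 Hb) μb
  -- (6) transport
  exact quotientMeasure_univ_lt_top_of_surjective_prod (cmDatum L 2 Ha).quotientSubgroup (cmDatum L 1 Hb).quotientSubgroup
    (Subgroup.centralizer ({(cmDatum L 3 H).toAdelic γ} : Set (cmDatum L 3 H).Adelic)) _ e hcont heC hCe hΓ μa hμa0 μb hμb0
    ρ νC

/-- **The quasi-split case `G = U(J₃) = U_{L/L⁺}(3)`** (★ `quasiSplit_eq_cmDatum`, `rfl`): for a rational
`γ ∈ U(J₃)(L⁺)` semisimple, not regular, not scalar — e.g. the torus element `d(a, b, a)`, `a ≠ b ∈ L¹`, of the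
singular Borel class of LAW 5 — the Weil covolume `vol(C(γ) ⧸ (U(J₃)(L⁺) ∩ C(γ)))` of ★
`lintegral_conjTsum_fiber_eq_mul_tsum_covol_mul` is FINITE for every Haar pair, although the centraliser
`U(1,1) × U(1)` is isotropic.  Stated in the (L4) currency (topological instance binders on `U(J₃)(𝔸)` as there;
the data instances are threaded explicitly through the `rfl` bridge). [cite: Rogawski1990, §7.2 Prop. 7.2.1 p. 91]
[cite: Borel1963, Thm. 5.8] -/
theorem quotientMeasure_centralizer_univ_lt_top_of_singular_quasiSplit
    [T2Space (quasiSplit (↥(maximalRealSubfield L)) L (IsCMField.complexConj L) 3).Adelic]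
    [LocallyCompactSpace (quasiSplit (↥(maximalRealSubfield L)) L (IsCMField.complexConj L) 3).Adelic]
    [SecondCountableTopology (quasiSplit (↥(maximalRealSubfield L)) L (IsCMField.complexConj L) 3).Adelic]
    (γ : (quasiSplit (↥(maximalRealSubfield L)) L (IsCMField.complexConj L) 3).Rational)
    (hss : Rogawski1990.IsSemisimpleElt (cmConjRingHom L) ((StdForm.antidiagonal 3).over L) γ)
    (hnreg : ¬ IsRegularElt (γ.val : GL (Fin 3) L))
    (hnsc : ∀ ζ : L, ((γ.val : GL (Fin 3) L) : Matrix (Fin 3) (Fin 3) L) ≠ ζ • 1)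
    [instM : MeasurableSpace (quasiSplit (↥(maximalRealSubfield L)) L (IsCMField.complexConj L) 3).Adelic]
    [instB : BorelSpace (quasiSplit (↥(maximalRealSubfield L)) L (IsCMField.complexConj L) 3).Adelic]
    [hCcl : IsClosed ((Subgroup.centralizer ({(quasiSplit (↥(maximalRealSubfield L)) L (IsCMField.complexConj L) 3).toAdelic γ} :
      Set (quasiSplit (↥(maximalRealSubfield L)) L (IsCMField.complexConj L) 3).Adelic)) :
      Set (quasiSplit (↥(maximalRealSubfield L)) L (IsCMField.complexConj L) 3).Adelic)]
    (hΛ : IsClosed (((((quasiSplit (↥(maximalRealSubfield L)) L (IsCMField.complexConj L) 3).quotientSubgroup ⊓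
        Subgroup.centralizer ({(quasiSplit (↥(maximalRealSubfield L)) L (IsCMField.complexConj L) 3).toAdelic γ} :
          Set (quasiSplit (↥(maximalRealSubfield L)) L (IsCMField.complexConj L) 3).Adelic)).subgroupOf
        (Subgroup.centralizer ({(quasiSplit (↥(maximalRealSubfield L)) L (IsCMField.complexConj L) 3).toAdelic γ} :
          Set (quasiSplit (↥(maximalRealSubfield L)) L (IsCMField.complexConj L) 3).Adelic))) :
        Subgroup ↥(Subgroup.centralizer ({(quasiSplit (↥(maximalRealSubfield L)) L (IsCMField.complexConj L) 3).toAdelic γ} :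
          Set (quasiSplit (↥(maximalRealSubfield L)) L (IsCMField.complexConj L) 3).Adelic))) :
      Set ↥(Subgroup.centralizer ({(quasiSplit (↥(maximalRealSubfield L)) L (IsCMField.complexConj L) 3).toAdelic γ} :
          Set (quasiSplit (↥(maximalRealSubfield L)) L (IsCMField.complexConj L) 3).Adelic))))
    [instMQ : MeasurableSpace (↥(Subgroup.centralizer ({(quasiSplit (↥(maximalRealSubfield L)) L (IsCMField.complexConj L) 3).toAdelic γ} :
        Set (quasiSplit (↥(maximalRealSubfield L)) L (IsCMField.complexConj L) 3).Adelic)) ⧸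
      ((quasiSplit (↥(maximalRealSubfield L)) L (IsCMField.complexConj L) 3).quotientSubgroup ⊓
        Subgroup.centralizer ({(quasiSplit (↥(maximalRealSubfield L)) L (IsCMField.complexConj L) 3).toAdelic γ} :
          Set (quasiSplit (↥(maximalRealSubfield L)) L (IsCMField.complexConj L) 3).Adelic)).subgroupOf
        (Subgroup.centralizer ({(quasiSplit (↥(maximalRealSubfield L)) L (IsCMField.complexConj L) 3).toAdelic γ} :
          Set (quasiSplit (↥(maximalRealSubfield L)) L (IsCMField.complexConj L) 3).Adelic)))]
    [instBQ : BorelSpace (↥(Subgroup.centralizer ({(quasiSplit (↥(maximalRealSubfield L)) L (IsCMField.complexConj L) 3).toAdelic γ} :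
        Set (quasiSplit (↥(maximalRealSubfield L)) L (IsCMField.complexConj L) 3).Adelic)) ⧸
      ((quasiSplit (↥(maximalRealSubfield L)) L (IsCMField.complexConj L) 3).quotientSubgroup ⊓
        Subgroup.centralizer ({(quasiSplit (↥(maximalRealSubfield L)) L (IsCMField.complexConj L) 3).toAdelic γ} :
          Set (quasiSplit (↥(maximalRealSubfield L)) L (IsCMField.complexConj L) 3).Adelic)).subgroupOf
        (Subgroup.centralizer ({(quasiSplit (↥(maximalRealSubfield L)) L (IsCMField.complexConj L) 3).toAdelic γ} :
          Set (quasiSplit (↥(maximalRealSubfield L)) L (IsCMField.complexConj L) 3).Adelic)))]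
    (ρ : Measure ↥(((quasiSplit (↥(maximalRealSubfield L)) L (IsCMField.complexConj L) 3).quotientSubgroup ⊓
        Subgroup.centralizer ({(quasiSplit (↥(maximalRealSubfield L)) L (IsCMField.complexConj L) 3).toAdelic γ} :
          Set (quasiSplit (↥(maximalRealSubfield L)) L (IsCMField.complexConj L) 3).Adelic)).subgroupOf
        (Subgroup.centralizer ({(quasiSplit (↥(maximalRealSubfield L)) L (IsCMField.complexConj L) 3).toAdelic γ} :
          Set (quasiSplit (↥(maximalRealSubfield L)) L (IsCMField.complexConj L) 3).Adelic))))
    [i₁ : ρ.IsMulLeftInvariant] [i₂ : IsFiniteMeasureOnCompacts ρ] [i₃ : ρ.IsOpenPosMeasure] [i₄ : ρ.IsInvInvariant] [i₅ : SFinite ρ]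
    (νC : Measure ↥(Subgroup.centralizer ({(quasiSplit (↥(maximalRealSubfield L)) L (IsCMField.complexConj L) 3).toAdelic γ} :
        Set (quasiSplit (↥(maximalRealSubfield L)) L (IsCMField.complexConj L) 3).Adelic)))
    [i₆ : IsHaarMeasure νC] [i₇ : νC.IsMulRightInvariant] :
    quotientMeasure (((quasiSplit (↥(maximalRealSubfield L)) L (IsCMField.complexConj L) 3).quotientSubgroup ⊓
        Subgroup.centralizer ({(quasiSplit (↥(maximalRealSubfield L)) L (IsCMField.complexConj L) 3).toAdelic γ} :
          Set (quasiSplit (↥(maximalRealSubfield L)) L (IsCMField.complexConj L) 3).Adelic)).subgroupOf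
        (Subgroup.centralizer ({(quasiSplit (↥(maximalRealSubfield L)) L (IsCMField.complexConj L) 3).toAdelic γ} :
          Set (quasiSplit (↥(maximalRealSubfield L)) L (IsCMField.complexConj L) 3).Adelic))) ρ hΛ νC
      Set.univ < ∞ :=
  @quotientMeasure_centralizer_univ_lt_top_of_singular L _ _ _ ((StdForm.antidiagonal 3).over L)
    (cmConj_antidiagonal_transpose L 3) (isUnit_det_antidiagonal_over L 3).ne_zero γ hss hnreg hnsc instM instB hCcl hΛ
    instMQ instBQ ρ i₁ i₂ i₃ i₄ i₅ νC i₆ i₇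

end Literature.NumberTheory.Automorphic.UnitaryGroup
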